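import Literature.Topology.FourManifolds.CircleLoopNullhomotopy
import Literature.Topology.FourManifolds.LinkingNumberWellDefined
import Literature.AlgebraicTopology.FundamentalGroup.IsotopyTrack
import HarnessLib

/-!
# Maps of the circle with conjugate loops are freely homotopic

Topic `Literature/Topology/FourManifolds`; general topology in the service of handle theory
(brick of the roadmap in `PresentationHandlebodyFiveProofs.lean`: two attaching circles which
*represent the same class* of the fundamental group — `HandleAttachingMap.RepresentsClass`,
a statement about based loops up to conjugation — must be fed to Whitney's theorem, which wants
the circles homotopic *as maps of `S¹`*).

The loop `t ↦ e (cos 2πt, sin 2πt)` of a map `e : C(S¹, Y)` is `ContinuousMap.circleLoop e`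
(`CircleLoopNullhomotopy.lean`), and two loops `β₀` (at `x₀`), `β₁` (at `x₁`) are *conjugate in
the fundamental groupoid*, `LoopConj β₀ β₁` (`LinkingNumberWellDefined.lean`), when
`[β₁] = [τ⁻¹ · β₀ · τ]` for a path `τ` from `x₀` to `x₁`.  The tree proves that freely homotopic
loops are conjugate (`LoopConj.of_square`); this file proves the **converse**:

* `Literature.Topology.FourManifolds.loopCircleMap`, `Literature.Topology.FourManifolds.pathCircleMap`
  — a loop `[0, 1] → Y` descends to a map of the circle (along the quotient map
  `circleParam : [0, 1] → S¹`), inverse to `ContinuousMap.circleLoop`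
  (`pathCircleMap_circleLoop`);
* `Literature.Topology.FourManifolds.loopCircleMap_homotopic_of_family` — a continuous family
  of loops (base points allowed to move) descends to a homotopy of circle maps;
* `Literature.Topology.FourManifolds.pathCircleMap_conj_homotopic` — the circle map of
  `τ⁻¹ · ℓ · τ` is homotopic to that of `ℓ` (slide the base point back along `τ`);
* `ContinuousMap.homotopic_of_loopConj` — **maps of the circle whose loops are conjugate are
  homotopic**; with `LoopConj.of_square` this is the classical bijection between free homotopy
  classes of maps `S¹ → Y` and conjugacy classes of the fundamental groupoid (Hatcher,
  *Algebraic Topology* (2002), §1.1, Ex. 6 / §4.A);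
* `ContinuousMap.homotopic_of_conj_mk_circleLoop_eq` — the form used for attaching circles: if
  `[δ₀ · ℓ(e₀) · δ₀⁻¹] = [δ₁ · ℓ(e₁) · δ₁⁻¹]` in `π₁(Y, v)` for connecting paths `δ₀`, `δ₁` from
  a base point `v`, then `e₀` and `e₁` are homotopic;
* `Literature.Topology.FourManifolds.LoopConj.of_map_of_bijective`,
  `ContinuousMap.homotopic_of_homotopic_comp_of_bijective` — conjugacy of loops, and free
  homotopy of circle maps, pull back along a map `f : A → Y` inducing a bijection on `π₁`
  (the passage from "homotopic in the 1-handlebody `V`" to "homotopic in `∂V`").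

Everything here is proved; no named facts are introduced.

## References

* A. Hatcher, *Algebraic Topology*, CUP (2002), §1.1 (Ex. 6: free homotopy classes of loops and
  conjugacy classes in `π₁`), proof of Lemma 1.19. [HatcherAT2002]
-/

open scoped unitInterval
open Set Function

noncomputable section

namespace Literature.Topology.FourManifolds

variable {Y : Type*} [TopologicalSpace Y]

/-! ### Descent of loops to maps of the circle -/

section Descent

/-- `circleParam : [0, 1] → S¹` is a quotient map (a continuous surjection from a compact space
to a Hausdorff space). [folklore] -/
theorem isQuotientMap_circleParam : Topology.IsQuotientMap circleParam :=
  Topology.IsQuotientMap.of_surjective_continuous circleParam_surjective circleParam.continuous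

/-- A map of `[0, 1]` with equal end values is constant on the fibres of `circleParam`.
[folklore] -/
theorem factorsThrough_circleParam {γ : C(I, Y)} (h : γ 0 = γ 1) :
    FactorsThrough γ circleParam := by
  intro s t hst
  rcases eq_or_eq_of_circlePoint_two_pi_mul_eq hst with rfl | ⟨rfl, rfl⟩ | ⟨rfl, rfl⟩
  · rfl
  · exact h
  · exact h.symm

/-- **Descent of a loop to a map of the circle**: for `γ : [0, 1] → Y` continuous with
`γ 0 = γ 1`, the map `e : S¹ → Y` with `e (cos 2πt, sin 2πt) = γ t`. [folklore] -/
def loopCircleMap (γ : C(I, Y)) (h : γ 0 = γ 1) :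
    C(Metric.sphere (0 : EuclideanSpace ℝ (Fin 2)) 1, Y) :=
  isQuotientMap_circleParam.lift γ (factorsThrough_circleParam h)

/-- The defining property of the descended map. [folklore] -/
@[simp] theorem loopCircleMap_circleParam (γ : C(I, Y)) (h : γ 0 = γ 1) (t : I) :
    loopCircleMap γ h (circleParam t) = γ t :=
  congrFun (congrArg DFunLike.coe
    (isQuotientMap_circleParam.lift_comp γ (factorsThrough_circleParam h))) t

/-- Pointwise equal loops descend to the same map of the circle. [folklore] -/
theorem loopCircleMap_congr {γ γ' : C(I, Y)} (h : γ 0 = γ 1) (h' : γ' 0 = γ' 1)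
    (e : ∀ t, γ t = γ' t) : loopCircleMap γ h = loopCircleMap γ' h' := by
  obtain rfl : γ = γ' := ContinuousMap.ext e
  rfl

/-- **Descent of a loop (a `Path` from `x` to `x`) to a map of the circle.** [folklore] -/
def pathCircleMap {x : Y} (p : Path x x) : C(Metric.sphere (0 : EuclideanSpace ℝ (Fin 2)) 1, Y) :=
  loopCircleMap (p : C(I, Y)) (p.source.trans p.target.symm)

/-- The defining property of the descended map of a loop. [folklore] -/
@[simp] theorem pathCircleMap_circleParam {x : Y} (p : Path x x) (t : I) :
    pathCircleMap p (circleParam t) = p t :=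
  loopCircleMap_circleParam _ _ t

/-- Pointwise equal loops (possibly recorded at different base points) descend to the same map
of the circle. [folklore] -/
theorem pathCircleMap_congr {x x' : Y} {p : Path x x} {q : Path x' x'} (e : ∀ t, p t = q t) :
    pathCircleMap p = pathCircleMap q := by
  ext u
  obtain ⟨t, rfl⟩ := circleParam_surjective u
  rw [pathCircleMap_circleParam, pathCircleMap_circleParam, e]

/-- **The loop of a map of the circle descends back to the map.** [folklore] -/
@[simp] theorem pathCircleMap_circleLoop (e : C(Metric.sphere (0 : EuclideanSpace ℝ (Fin 2)) 1, Y)) :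
    pathCircleMap e.circleLoop = e := by
  ext u
  obtain ⟨t, rfl⟩ := circleParam_surjective u
  rw [pathCircleMap_circleParam, ContinuousMap.circleLoop_apply]

/-- **A continuous family of loops descends to a homotopy of maps of the circle.**  Let
`G : [0, 1] × [0, 1] → Y` be continuous with `G (s, 0) = G (s, 1)` for every `s` (a family of
loops whose base points `G (s, 0)` may move), starting at the loop `γ₀` and ending at `γ₁`.
Then the descended circle maps of `γ₀` and `γ₁` are homotopic: `G` descends along the quotient
map `[0, 1] × [0, 1] → [0, 1] × S¹` (the argument of
`ContinuousMap.homotopic_const_of_circleLoop_homotopic_refl`).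
[cite: HatcherAT2002, §1.1, proof of Lemma 1.19] -/
theorem loopCircleMap_homotopic_of_family (G : C(I × I, Y)) (hG : ∀ s, G (s, 0) = G (s, 1))
    {γ₀ γ₁ : C(I, Y)} (h₀ : γ₀ 0 = γ₀ 1) (h₁ : γ₁ 0 = γ₁ 1)
    (hG0 : ∀ t, G (0, t) = γ₀ t) (hG1 : ∀ t, G (1, t) = γ₁ t) :
    (loopCircleMap γ₀ h₀).Homotopic (loopCircleMap γ₁ h₁) := by
  -- the quotient map `Q (s, t) = (s, q t)`
  set Q : C(I × I, I × Metric.sphere (0 : EuclideanSpace ℝ (Fin 2)) 1) :=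
    ⟨fun p => (p.1, circleParam p.2), continuous_fst.prodMk (circleParam.continuous.comp
      continuous_snd)⟩ with hQ
  have hQs : Surjective Q := fun p => by
    obtain ⟨t, ht⟩ := circleParam_surjective p.2
    exact ⟨(p.1, t), Prod.ext rfl ht⟩
  have hQq : Topology.IsQuotientMap Q :=
    Topology.IsQuotientMap.of_surjective_continuous hQs Q.continuous
  -- `G` is constant on the fibres of `Q`
  have hfac : Function.FactorsThrough G Q := by
    rintro ⟨s, t⟩ ⟨s', t'⟩ hst
    obtain ⟨hss', htt'⟩ := Prod.mk.inj hst
    subst hss'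
    show G (s, t) = G (s, t')
    rcases eq_or_eq_of_circlePoint_two_pi_mul_eq htt' with rfl | ⟨rfl, rfl⟩ | ⟨rfl, rfl⟩
    · rfl
    · exact hG s
    · exact (hG s).symm
  set Gh : C(I × Metric.sphere (0 : EuclideanSpace ℝ (Fin 2)) 1, Y) := hQq.lift G hfac with hGh
  have hGQ : ∀ s t, Gh (s, circleParam t) = G (s, t) := fun s t =>
    congrFun (congrArg DFunLike.coe (hQq.lift_comp G hfac)) (s, t)
  refine ⟨{ toContinuousMap := Gh, map_zero_left := fun u => ?_, map_one_left := fun u => ?_ }⟩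
  · obtain ⟨t, rfl⟩ := circleParam_surjective u
    show Gh (0, circleParam t) = loopCircleMap γ₀ h₀ (circleParam t)
    rw [hGQ, hG0, loopCircleMap_circleParam]
  · obtain ⟨t, rfl⟩ := circleParam_surjective u
    show Gh (1, circleParam t) = loopCircleMap γ₁ h₁ (circleParam t)
    rw [hGQ, hG1, loopCircleMap_circleParam]

/-- **Homotopic loops (rel end points) descend to homotopic maps of the circle.** [folklore] -/
theorem pathCircleMap_homotopic_of_homotopic {x : Y} {p q : Path x x} (h : p.Homotopic q) :
    (pathCircleMap p).Homotopic (pathCircleMap q) := by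
  obtain ⟨H⟩ := h
  exact loopCircleMap_homotopic_of_family H.toContinuousMap
    (fun s => (H.source s).trans (H.target s).symm) _ _ (fun t => H.apply_zero t)
    (fun t => H.apply_one t)

end Descent

/-! ### Sliding the base point along a path: the circle map of `τ⁻¹ · ℓ · τ` -/

section Conj

variable {x₀ x₁ : Y}

/-- **The family of loops `σₛ⁻¹ · ℓ · σₛ`**, `σₛ = τ|[0, s]` rescaled to unit length
(`σₛ u = τ (s u)`), written out on the three time intervals `[0, 1/2]` (`σₛ` backwards),
`[1/2, 3/4]` (`ℓ`), `[3/4, 1]` (`σₛ`) of the concatenation `τ⁻¹ · (ℓ · τ)`: a continuous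
family of loops based at `τ s`, from (a reparametrisation of) `ℓ` at `s = 0` to `τ⁻¹ · ℓ · τ`
at `s = 1`. [cite: HatcherAT2002, §1.1, proof of Lemma 1.19] -/
def conjFamilyFun (ℓ : Path x₀ x₀) (τ : Path x₀ x₁) (p : I × I) : Y :=
  if (p.2 : ℝ) ≤ 1 / 2 then τ.extend (p.1 * (1 - 2 * p.2))
  else if (p.2 : ℝ) ≤ 3 / 4 then ℓ.extend (4 * p.2 - 2) else τ.extend (p.1 * (4 * p.2 - 3))

/-- The family `σₛ⁻¹ · ℓ · σₛ` is jointly continuous (the three pieces agree where they meet,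
at the base point `x₀` of `ℓ`). [folklore] -/
theorem continuous_conjFamilyFun (ℓ : Path x₀ x₀) (τ : Path x₀ x₁) :
    Continuous (conjFamilyFun ℓ τ) := by
  have hs : Continuous fun p : I × I => (p.1 : ℝ) := continuous_subtype_val.comp continuous_fst
  have ht : Continuous fun p : I × I => (p.2 : ℝ) := continuous_subtype_val.comp continuous_snd
  have h₁ : Continuous fun p : I × I => τ.extend (p.1 * (1 - 2 * p.2)) :=
    τ.continuous_extend.comp (hs.mul (continuous_const.sub (continuous_const.mul ht)))
  have h₂ : Continuous fun p : I × I => ℓ.extend (4 * p.2 - 2) :=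
    ℓ.continuous_extend.comp ((continuous_const.mul ht).sub continuous_const)
  have h₃ : Continuous fun p : I × I => τ.extend (p.1 * (4 * p.2 - 3)) :=
    τ.continuous_extend.comp (hs.mul ((continuous_const.mul ht).sub continuous_const))
  have h₂₃ : Continuous fun p : I × I =>
      if (p.2 : ℝ) ≤ 3 / 4 then ℓ.extend (4 * p.2 - 2) else τ.extend (p.1 * (4 * p.2 - 3)) := by
    refine Continuous.if_le h₂ h₃ ht continuous_const fun p hp => ?_
    rw [hp]
    norm_num [Path.extend_one, Path.extend_zero]
  refine Continuous.if_le h₁ h₂₃ ht continuous_const fun p hp => ?_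
  have hle : (p.2 : ℝ) ≤ 3 / 4 := by rw [hp]; norm_num
  rw [if_pos hle, hp]
  norm_num [Path.extend_zero]

/-- The family `σₛ⁻¹ · ℓ · σₛ` as a continuous map of the square. [folklore] -/
def conjFamily (ℓ : Path x₀ x₀) (τ : Path x₀ x₁) : C(I × I, Y) :=
  ⟨conjFamilyFun ℓ τ, continuous_conjFamilyFun ℓ τ⟩

/-- Unfolding lemma for `conjFamily`. [folklore] -/
@[simp] theorem conjFamily_apply (ℓ : Path x₀ x₀) (τ : Path x₀ x₁) (p : I × I) :
    conjFamily ℓ τ p = conjFamilyFun ℓ τ p := rfl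

/-- Each stage of the family is a loop (at `τ s`). [folklore] -/
theorem conjFamilyFun_zero_eq_one (ℓ : Path x₀ x₀) (τ : Path x₀ x₁) (s : I) :
    conjFamilyFun ℓ τ (s, 0) = conjFamilyFun ℓ τ (s, 1) := by
  simp only [conjFamilyFun, Set.Icc.coe_zero, Set.Icc.coe_one]
  norm_num

/-- **At `s = 1` the family is the loop `τ⁻¹ · (ℓ · τ)`** (pointwise, with Mathlib's
parametrisation of `Path.trans`). [folklore] -/
theorem conjFamilyFun_one (ℓ : Path x₀ x₀) (τ : Path x₀ x₁) (t : I) :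
    conjFamilyFun ℓ τ (1, t) = (τ.symm.trans (ℓ.trans τ)) t := by
  obtain ⟨t, ht0, ht1⟩ := t
  simp only [conjFamilyFun, Set.Icc.coe_one, one_mul, Path.trans_apply, Path.symm_apply,
    Function.comp_apply]
  by_cases h₁ : t ≤ 1 / 2
  · rw [if_pos h₁, dif_pos h₁,
      Path.extend_apply τ (t := 1 - 2 * t) ⟨by linarith, by linarith⟩]
    try exact congrArg τ (Subtype.ext (by simp [unitInterval.coe_symm_eq]))
  · rw [if_neg h₁, dif_neg h₁]
    by_cases h₂ : t ≤ 3 / 4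
    · have h₂' : (2 * t - 1 : ℝ) ≤ 1 / 2 := by linarith
      rw [if_pos h₂, dif_pos h₂',
        Path.extend_apply ℓ (t := 4 * t - 2) ⟨by linarith, by linarith⟩]
      try exact congrArg ℓ (Subtype.ext (by push_cast; ring))
    · have h₂' : ¬ (2 * t - 1 : ℝ) ≤ 1 / 2 := fun h => h₂ (by linarith)
      rw [if_neg h₂, dif_neg h₂',
        Path.extend_apply τ (t := 4 * t - 3) ⟨by linarith, by linarith⟩]
      try exact congrArg τ (Subtype.ext (by push_cast; ring))

/-- **At `s = 0` the family is the loop `refl⁻¹ · (ℓ · refl)`**: the stage `s = 0` of the family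
for `τ` is the stage `s = 1` of the family for the constant path. [folklore] -/
theorem conjFamilyFun_zero (ℓ : Path x₀ x₀) (τ : Path x₀ x₁) (t : I) :
    conjFamilyFun ℓ τ (0, t) = conjFamilyFun ℓ (Path.refl x₀) (1, t) := by
  simp only [conjFamilyFun, Set.Icc.coe_zero, Set.Icc.coe_one, zero_mul, one_mul,
    Path.extend_zero, Path.refl_extend, ContinuousMap.const_apply]

/-- **Sliding the base point back: the circle map of `τ⁻¹ · ℓ · τ` is homotopic to the circle
map of `ℓ`.**  The family `σₛ⁻¹ · ℓ · σₛ` (`conjFamily`) descends to a homotopy of circle maps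
from the circle map of `refl⁻¹ · ℓ · refl` to that of `τ⁻¹ · ℓ · τ`
(`loopCircleMap_homotopic_of_family`), and `refl⁻¹ · ℓ · refl ≃ ℓ` rel end points.
[cite: HatcherAT2002, §1.1, Ex. 6 and proof of Lemma 1.19] -/
theorem pathCircleMap_conj_homotopic (ℓ : Path x₀ x₀) (τ : Path x₀ x₁) :
    (pathCircleMap (τ.symm.trans (ℓ.trans τ))).Homotopic (pathCircleMap ℓ) := by
  -- from the reparametrised `ℓ` (conjugation by the constant path) to `τ⁻¹ · ℓ · τ`
  have hfam : (pathCircleMap ((Path.refl x₀).symm.trans (ℓ.trans (Path.refl x₀)))).Homotopic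
      (pathCircleMap (τ.symm.trans (ℓ.trans τ))) :=
    loopCircleMap_homotopic_of_family (conjFamily ℓ τ) (conjFamilyFun_zero_eq_one ℓ τ) _ _
      (fun t => by
        rw [conjFamily_apply, conjFamilyFun_zero, conjFamilyFun_one]
        rfl)
      (fun t => by
        rw [conjFamily_apply, conjFamilyFun_one]
        rfl)
  -- `refl⁻¹ · (ℓ · refl) ≃ ℓ` rel end points
  have hrefl : ((Path.refl x₀).symm.trans (ℓ.trans (Path.refl x₀))).Homotopic ℓ := by
    rw [Path.refl_symm]
    exact ⟨(Path.Homotopy.reflTrans _).trans (Path.Homotopy.transRefl ℓ)⟩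
  exact hfam.symm.trans (pathCircleMap_homotopic_of_homotopic hrefl)

end Conj

/-! ### Conjugate loops give homotopic maps of the circle -/

section Main

/-- **Maps of the circle whose loops are conjugate in the fundamental groupoid are homotopic.**
If `[ℓ(e₁)] = [τ⁻¹ · ℓ(e₀) · τ]` for a path `τ` between the base points (`LoopConj`), then
`e₀ ≃ e₁`: `e₁` is the circle map of its loop, which is homotopic rel end points to
`τ⁻¹ · ℓ(e₀) · τ`, whose circle map is homotopic to that of `ℓ(e₀)`, i.e. to `e₀`
(`pathCircleMap_conj_homotopic`).  Converse of the tree's `LoopConj.of_square`.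
[cite: HatcherAT2002, §1.1, Ex. 6] -/
theorem _root_.ContinuousMap.homotopic_of_loopConj
    {e₀ e₁ : C(Metric.sphere (0 : EuclideanSpace ℝ (Fin 2)) 1, Y)}
    (h : LoopConj e₀.circleLoop e₁.circleLoop) : e₀.Homotopic e₁ := by
  obtain ⟨τ, hτ⟩ := h
  have h₁ : e₁.circleLoop.Homotopic (τ.symm.trans (e₀.circleLoop.trans τ)) :=
    Path.Homotopic.Quotient.eq.1 hτ
  have hA : e₁.Homotopic (pathCircleMap (τ.symm.trans (e₀.circleLoop.trans τ))) := by
    have h := pathCircleMap_homotopic_of_homotopic h₁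
    rwa [pathCircleMap_circleLoop] at h
  have hB := pathCircleMap_conj_homotopic e₀.circleLoop τ
  rw [pathCircleMap_circleLoop] at hB
  exact (hA.trans hB).symm

/-- **Free homotopy classes of maps of the circle are the conjugacy classes of the fundamental
groupoid**: `e₀ ≃ e₁` iff their loops are conjugate (`ContinuousMap.homotopic_of_loopConj` and
the tree's `LoopConj.of_square`). [cite: HatcherAT2002, §1.1, Ex. 6] -/
theorem _root_.ContinuousMap.homotopic_iff_loopConj
    (e₀ e₁ : C(Metric.sphere (0 : EuclideanSpace ℝ (Fin 2)) 1, Y)) :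
    e₀.Homotopic e₁ ↔ LoopConj e₀.circleLoop e₁.circleLoop := by
  refine ⟨fun ⟨F⟩ => ?_, ContinuousMap.homotopic_of_loopConj⟩
  -- the square `(s, t) ↦ F (s, circleParam t)`
  set G : C(I × I, Y) := F.toContinuousMap.comp
    ⟨fun p => (p.1, circleParam p.2), continuous_fst.prodMk (circleParam.continuous.comp
      continuous_snd)⟩ with hG
  have hG0 : ∀ s, G (s, 0) = G (s, 1) := fun s => by
    simp only [hG, ContinuousMap.comp_apply, ContinuousMap.coe_mk, circleParam_zero,
      circleParam_one]
  refine LoopConj.of_square G hG0 e₀.circleLoop e₁.circleLoop (fun t => ?_) (fun t => ?_)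
  · simp only [hG, ContinuousMap.comp_apply, ContinuousMap.coe_mk,
      ContinuousMap.Homotopy.coe_toContinuousMap, F.apply_zero, ContinuousMap.circleLoop_apply]
  · simp only [hG, ContinuousMap.comp_apply, ContinuousMap.coe_mk,
      ContinuousMap.Homotopy.coe_toContinuousMap, F.apply_one, ContinuousMap.circleLoop_apply]

/-- **Attaching-circle form.**  If, for connecting paths `δ₀`, `δ₁` from a base point `v` to the
base points of two maps of the circle, the based loops `δ₀ · ℓ(e₀) · δ₀⁻¹` and `δ₁ · ℓ(e₁) · δ₁⁻¹`
have the same class in `π₁(Y, v)` (the two circles *represent the same class*, cf.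
`HandleAttachingMap.RepresentsClass`), then `e₀ ≃ e₁` as maps of the circle.
[cite: HatcherAT2002, §1.1, Ex. 6] -/
theorem _root_.ContinuousMap.homotopic_of_conj_mk_circleLoop_eq {v : Y}
    {e₀ e₁ : C(Metric.sphere (0 : EuclideanSpace ℝ (Fin 2)) 1, Y)}
    (δ₀ : Path v (e₀ (circlePoint 0))) (δ₁ : Path v (e₁ (circlePoint 0)))
    (h : Path.Homotopic.Quotient.mk ((δ₀.trans e₀.circleLoop).trans δ₀.symm) =
      Path.Homotopic.Quotient.mk ((δ₁.trans e₁.circleLoop).trans δ₁.symm)) :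
    e₀.Homotopic e₁ := by
  refine ContinuousMap.homotopic_of_loopConj ⟨δ₀.symm.trans δ₁, ?_⟩
  -- groupoid algebra: `[ℓ₁] = [(δ₀⁻¹ δ₁)⁻¹ · ℓ₀ · (δ₀⁻¹ δ₁)]` from `[δ₀ ℓ₀ δ₀⁻¹] = [δ₁ ℓ₁ δ₁⁻¹]`
  simp only [Path.Homotopic.Quotient.mk_trans, Path.Homotopic.Quotient.mk_symm] at h ⊢
  set a := Path.Homotopic.Quotient.mk δ₀ with ha
  set b := Path.Homotopic.Quotient.mk δ₁ with hb
  set l₀ := Path.Homotopic.Quotient.mk e₀.circleLoop with hl₀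
  set l₁ := Path.Homotopic.Quotient.mk e₁.circleLoop with hl₁
  -- `h : (a · l₀) · a⁻¹ = (b · l₁) · b⁻¹`; conjugate both sides by `b`
  have h' : ((b.symm.trans ((a.trans l₀).trans a.symm)).trans b) =
      ((b.symm.trans ((b.trans l₁).trans b.symm)).trans b) := by rw [h]
  have hr : ((b.symm.trans ((b.trans l₁).trans b.symm)).trans b) = l₁ := by
    simp only [Path.Homotopic.Quotient.trans_assoc, Path.Homotopic.Quotient.symm_trans,
      Path.Homotopic.Quotient.trans_refl]
    rw [← Path.Homotopic.Quotient.trans_assoc, Path.Homotopic.Quotient.symm_trans,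
      Path.Homotopic.Quotient.refl_trans]
  rw [hr] at h'
  rw [← h']
  simp only [Path.Homotopic.Quotient.trans_symm', Path.Homotopic.Quotient.symm_symm',
    Path.Homotopic.Quotient.trans_assoc]

end Main

/-! ### Pulling free homotopies back along maps which are bijective on `π₁` -/

section PullBack

variable {A : Type*} [TopologicalSpace A]

/-- `[(γ⁻¹) ∘ h] = [γ ∘ h]⁻¹` in the fundamental groupoid. [folklore] -/
theorem Path.Homotopic.Quotient.mk_map_symm {x y : A} (γ : Path x y) {g : A → Y}
    (h : Continuous g) :
    Path.Homotopic.Quotient.mk (γ.symm.map h) = (Path.Homotopic.Quotient.mk (γ.map h)).symm := by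
  rw [← Path.map_symm, Path.Homotopic.Quotient.mk_symm]

/-- **Conjugacy of loops pulls back along a map inducing a bijection on fundamental groups.**
Let `f : A → Y` be continuous, `τ₀` a path in `A` between the base points `a`, `a'` of two loops
`β₀`, `β₁` of `A`, and suppose `f_* : π₁(A, a') → π₁(Y, f a')` is bijective.  If `f ∘ β₀` and
`f ∘ β₁` are conjugate in the fundamental groupoid of `Y`, then `β₀` and `β₁` are conjugate in
that of `A`: writing the conjugating path as `τ = (f ∘ τ₀) · c` with `c` a loop at `f a'`,
surjectivity gives `c = f_* [γ₀]`, and injectivity turns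
`f_* [β₁] = f_* [(τ₀ γ₀)⁻¹ · β₀ · (τ₀ γ₀)]` into the conjugacy `[β₁] = [(τ₀ γ₀)⁻¹ β₀ (τ₀ γ₀)]`.
(Used with `A = ∂V ⊆ V = Y` for a 1-handlebody `V` of dimension `≥ 4`, where the inclusion is
bijective on `π₁`.) [cite: HatcherAT2002, §1.1, Ex. 6] -/
theorem LoopConj.of_map_of_bijective (f : C(A, Y)) {a a' : A} (τ₀ : Path a a')
    (hb : Function.Bijective (FundamentalGroup.mapOfEq f (rfl : f a' = f a')))
    {β₀ : Path a a} {β₁ : Path a' a'}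
    (h : LoopConj (β₀.map f.continuous) (β₁.map f.continuous)) : LoopConj β₀ β₁ := by
  obtain ⟨τ, hτ⟩ := h
  -- the loop `(f ∘ τ₀)⁻¹ · τ` at `f a'` is the image of a loop `γ₀` of `A`
  obtain ⟨g, hg⟩ := hb.2 (FundamentalGroup.fromPath
    (Path.Homotopic.Quotient.mk ((τ₀.map f.continuous).symm.trans τ)))
  obtain ⟨γ₀, rfl⟩ : ∃ γ₀ : Path a' a', Path.Homotopic.Quotient.mk γ₀ = g :=
    Path.Homotopic.Quotient.mk_surjective g
  rw [FundamentalGroup.mapOfEq_apply] at hg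
  change Path.Homotopic.Quotient.mk (γ₀.map f.continuous) =
    Path.Homotopic.Quotient.mk ((τ₀.map f.continuous).symm.trans τ) at hg
  refine ⟨τ₀.trans γ₀, ?_⟩
  -- injectivity of `f_*` reduces the claim to an identity in the fundamental groupoid of `Y`
  suffices hs : FundamentalGroup.mapOfEq f (rfl : f a' = f a')
      (FundamentalGroup.fromPath (Path.Homotopic.Quotient.mk β₁)) =
      FundamentalGroup.mapOfEq f (rfl : f a' = f a') (FundamentalGroup.fromPath
        (Path.Homotopic.Quotient.mk ((τ₀.trans γ₀).symm.trans (β₀.trans (τ₀.trans γ₀))))) by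
    exact hb.1 hs
  rw [FundamentalGroup.mapOfEq_apply, FundamentalGroup.mapOfEq_apply]
  change Path.Homotopic.Quotient.mk (β₁.map f.continuous) = Path.Homotopic.Quotient.mk
    (((τ₀.trans γ₀).symm.trans (β₀.trans (τ₀.trans γ₀))).map f.continuous)
  rw [hτ]
  simp only [Path.trans_symm, Path.map_trans, Path.Homotopic.Quotient.mk_map_symm,
    Path.Homotopic.Quotient.mk_trans, Path.Homotopic.Quotient.mk_symm] at hg ⊢
  rw [hg]
  simp only [Path.Homotopic.Quotient.trans_symm', Path.Homotopic.Quotient.symm_symm',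
    Path.Homotopic.Quotient.trans_assoc,
    Literature.AlgebraicTopology.FundamentalGroup.IsotopyTrack.quotient_trans_symm_trans]

/-- **Free homotopies of circle maps pull back along maps bijective on `π₁`.**  If
`f : A → Y` induces a bijection `π₁(A, e₁(1,0)) → π₁(Y, f (e₁(1,0)))`, the base points of
`e₀ e₁ : C(S¹, A)` are joined by a path in `A`, and `f ∘ e₀ ≃ f ∘ e₁`, then `e₀ ≃ e₁`
(`ContinuousMap.homotopic_iff_loopConj` on both sides and `LoopConj.of_map_of_bijective`).
[cite: HatcherAT2002, §1.1, Ex. 6] -/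
theorem _root_.ContinuousMap.homotopic_of_homotopic_comp_of_bijective (f : C(A, Y))
    {e₀ e₁ : C(Metric.sphere (0 : EuclideanSpace ℝ (Fin 2)) 1, A)}
    (τ₀ : Path (e₀ (circlePoint 0)) (e₁ (circlePoint 0)))
    (hb : Function.Bijective
      (FundamentalGroup.mapOfEq f (rfl : f (e₁ (circlePoint 0)) = f (e₁ (circlePoint 0)))))
    (h : (f.comp e₀).Homotopic (f.comp e₁)) : e₀.Homotopic e₁ := by
  refine ContinuousMap.homotopic_of_loopConj (LoopConj.of_map_of_bijective f τ₀ hb ?_)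
  have h' := (ContinuousMap.homotopic_iff_loopConj _ _).1 h
  rwa [ContinuousMap.circleLoop_comp, ContinuousMap.circleLoop_comp] at h'

end PullBack

end Literature.Topology.FourManifolds
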